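import Summits.AtomisticToContinuum.Crystallization.Theorems.ChartedZeroExcessLayeredLatticeLiouvilleUF

/-!
# Zero-excess layered lattice Liouville — part UG (lens-2 g47, node «ElasticDress» beneath [T_esc] `EscapingTameWindowPG` and [T] `TameWindowPG`):
# the special/generic cut of the hot-star exclusion by an ELASTIC ENVELOPE — `[T] ⟺ [D_w] DressedTameWindowPG ∧ [T_b] BareTameWindowPG` (PROVED),
# the special side fed by the LOCAL statement [I_D] `DressedCorePG`; SANDWICH with part UF (PROVED): `[I_D](8) ⇒ [I_K](tight)` and `[T_esc](tight) ⇒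
# [T_b] ⇒ [T_esc](loose)` — the g46 residual of record is cut, and [T]'s named failure scenario (isolated hot core + `r⁻³` halo) MOVES to the special side

Line `_16XH19(_tol)` of statement 26636, (M)-side, after parts UC–UF: (M) ⟸ Gehring-leaf ∧ [I_K] ∧ [T_esc] ∧ [KS] ∧ [W] ∧ [CC°_W], every seam proved.
THE OBJECTION THIS FILE ANSWERS (critic row 778, by the critic's own linear-elastic estimate): a minimally `ϑ`-hot star (`ϑ = 1/20`, core radius `4`)
that is a self-equilibrated elastic anomaly drags a force-dipole halo of star misfit `m(r) ≈ ϑ·(4/r)³` (`6.3·10⁻³` at `r = 8`, `1.9·10⁻³` at `12`,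
`7.8·10⁻⁴` at `16`; below `calmLevel = 5·10⁻⁴` only beyond `r ≈ 18.6`), so at the FLAT calm level of parts UE/UF on the collar/moat `(8, 16)` it is
clouded and, for containers of `≤ 7` sites, escaping (six `8`-balls, volume `6·2145`, cannot cover the `(8,16)`-shell, volume `15 013`): the cuts of
g45/g46 may leave [T]'s named scenario in the residual.  The defect is the flat profile — an elastic halo is never flat.  This file measures the moat
(inner radius now a PARAMETER `r₀`, row 778 (c); `moatIn S K 8 ℓ = moat S K ℓ` by `rfl`) against a DECAYING ENVELOPE `envelope e p d = e·(8/d)^p` at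
distance `d` from a core (`p = 0`, `r₀ = 8` is part UF verbatim: `isDressed_zero_iff`).  CURRENCY: `x` is DRESSED (`IsDressed ϑe ωe p r₀ ℓ M S H x`) if
some container `K ∋ x` of `≤ M` sites has every star of `moatIn S K r₀ ℓ` `(ϑe(8/d)^p, ωe(8/d)^p)`-coherent to the chart (part UD), `d` = distance to
some core.  SANDWICH (PROVED; `8 ≤ r₀`, `ϑc ≤ envelope ϑe p ℓ` — at the record `1/2000 ≤ (1/100)(8/16)² = 1/400`): `IsEnclosed ϑc ωc ℓ M ⇒ IsDressed
ϑe ωe p r₀ ℓ M`, `IsDressed ϑe ωe p 8 ℓ M ⇒ IsEnclosed ϑe ωe ℓ M` — interpolation by SHAPE (loose near the cores, tight far out), which no flat level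
reproduces.  ONE-CONTAINER CERTIFICATE (PROVED, `isDressed_singleton`): at the record `(ϑe, p) = (1/100, 2)` the envelope reads `1.0·10⁻² / 4.4·10⁻³
/ 2.5·10⁻³` at `d = 8 / 12 / 16` against the halo's `6.3·10⁻³ / 1.9·10⁻³ / 7.8·10⁻⁴` (room `1.6 / 2.3 / 3.2`; tilt alike): the named scenario is DRESSED.
THE CUT (`em` on `IsDressed`; [T] recovered EXACTLY: `tameWindowPG_iff_dressedTameWindow_and_bare`, the one `iff` between Props here): SPECIAL =
DRESSED hot stars — [D_w] (WEAKER than [T], PROVED) fed by the LOCAL [I_D] (no window, no registration; MECHANISM-NAMED: halo slaving inside the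
perturbative basin + the finite core gap of part UF; UNDECIDED, tests (F0g) «DressScan» / (F0d″) «DressGap»; ATTACKABLE·L once (F0d″) reports); GENERIC = BARE —
[T_b] (WEAKER than [T] and than [T_esc](ϑc), PROVED; STRICTLY at currency level by the named scenario): by `exists_superEnvelope_of_not_isDressed`
(PROVED) every container of `≤ M` sites around a bare star meets a SUPER-ELASTIC companion — a star warmer than any elastic halo of the container allows
there, i.e. another SOURCE; iterating (moat extension): sources of `r₀`-DOMINATION number `> M`, `ℓ`-linked (row 780 (2)); NEW · UNDECIDED, test (F0g),
INSTRUMENTABLE, IDEA-NEEDED.  DIALS `DressedCorePG.mono` / `BareTameWindowPG.anti`; ENDS guarded (`M = 0`; `ℓ ≤ r₀`).  Record `(ϑ; ϑe, ωe, p, r₀, ℓ, M) = (1/20; 1/100, 1/100, 2, 8, 16, 12)`.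
WHY THIS IS NOVEL (by construction).  g43–g46 cut by amplitude, by one collar's geometry, by the connectivity of the non-calm set — all at FLAT levels;
g47 cuts by the RADIAL PROFILE of the misfit around the cores (sub-elastic decay vs super-elastic companion): the dichotomy «structured = far field of a
compact source / generic = needs another source» — the multipole reading of lattice defect equilibria (Braun–Hudson–Ortner) used as a CUT, not as an
expansion; no literature claim is made by the three Props; the other lenses' nodes read 11071, 14231, 31280, 27623, 27506 — none reads 26636.
-/

noncomputable section

open MeasureTheory Set Metric Filter Topology
open Summit.AtomisticToContinuum.Crystallization.Theorems.ChartedPlanarOrderRigidityDoor (E3 atomsIn)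
open Summit.AtomisticToContinuum.Crystallization.Theorems.ChartedPlanarOrderDensityDichotomy (μS nK)
open Summit.AtomisticToContinuum.Crystallization.Theorems.ChartedPlanarOrderMesoCut (LayeredHom)
open Summit.AtomisticToContinuum.Crystallization.Theorems.ChartedPlanarOrderDoorLayered (atomsIn_subset)
open Summit.AtomisticToContinuum.Crystallization.Theorems.ChartedPlanarOrderDoorLayeredOsc (IsTwoShellAffineGood)
open Literature.Analysis.PDE (ZatorskaGoldstein2005_localGehringLemmaCounting)

namespace Summit.AtomisticToContinuum.Crystallization.Theorems.ChartedZeroExcessLayeredLatticeLiouville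

/-! ### YG.1  The elastic envelope, the moat with inner radius `r₀`, sites under the envelope, dressed sites (the currency of the cut) -/

/-- ★ **`envelope e p d = e·(8/d)^p`** — the ENVELOPE LEVEL at distance `d` from a core, amplitude `e` normalised at `d = 8` (twice the star radius);
`p = 0`: the flat level of parts UE/UF; `p = 2`: the record, dominating the `d⁻³` decay of a force-dipole halo. [this file, g47] -/
def envelope (e : ℝ) (p : ℕ) (d : ℝ) : ℝ := e * (8 / d) ^ p

/-- at exponent `0` the envelope is the flat level. [this file, g47] -/
theorem envelope_exp_zero (e d : ℝ) : envelope e 0 d = e := by simp [envelope]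

/-- beyond distance `8` the envelope never exceeds its amplitude: dressed sites are enclosed at the LOOSE level. [this file, g47] -/
theorem envelope_le_amp {e d : ℝ} (he : 0 ≤ e) (hd : 8 ≤ d) (p : ℕ) : envelope e p d ≤ e :=
  mul_le_of_le_one_right he (pow_le_one₀ (div_nonneg (by norm_num) (by linarith)) ((div_le_one (by linarith)).2 hd))

/-- the envelope DECAYS: a flat level below its far end `envelope e p ℓ` lies below it on the whole moat (tight-enclosed ⇒ dressed). [this file, g47] -/
theorem envelope_outer_le {e d ℓ : ℝ} (he : 0 ≤ e) (hd : 0 < d) (hdℓ : d ≤ ℓ) (p : ℕ) : envelope e p ℓ ≤ envelope e p d :=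
  mul_le_mul_of_nonneg_left (pow_le_pow_left₀ (div_nonneg (by norm_num) (hd.le.trans hdℓ)) (div_le_div_of_nonneg_left (by norm_num) hd hdℓ) p) he

/-- a larger exponent is a TIGHTER envelope beyond distance `8`. [this file, g47] -/
theorem envelope_anti_exp {e d : ℝ} (he : 0 ≤ e) (hd : 8 ≤ d) {p p' : ℕ} (hp : p ≤ p') : envelope e p' d ≤ envelope e p d :=
  mul_le_mul_of_nonneg_left (pow_le_pow_of_le_one (div_nonneg (by norm_num) (by linarith)) ((div_le_one (by linarith)).2 hd) hp) he

/-- a larger amplitude is a LOOSER envelope. [this file, g47] -/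
theorem envelope_mono_amp {e e' d : ℝ} (h : e ≤ e') (hd : 0 ≤ d) (p : ℕ) : envelope e p d ≤ envelope e' p d :=
  mul_le_mul_of_nonneg_right h (pow_nonneg (div_nonneg (by norm_num) hd) p)

/-- coherence of a single star is monotone in both tolerances (part UD states the set form only). [this file, g47] -/
theorem IsCoherentStar.mono {ϑ₁ ϑ₁' ω₁ ω₁' : ℝ} (hϑ : ϑ₁ ≤ ϑ₁') (hω : ω₁ ≤ ω₁') {S H : Set E3} {x : E3} (h : IsCoherentStar ϑ₁ ω₁ S H x) :
    IsCoherentStar ϑ₁' ω₁' S H x := by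
  obtain ⟨U, g, hU, ht, hg, hb⟩ := h
  exact ⟨U, g, hU, ht.trans hω, hg, fun p hp hpx => (hb p hp hpx).trans hϑ⟩

/-- ★ **`moatIn S K r₀ ℓ`** — the MOAT of the container `K` with INNER RADIUS `r₀` a parameter (row 778 (c)): the sites of `S` within `ℓ` of some
core and farther than `r₀` from every core; `moatIn S K 8 ℓ = moat S K ℓ` (part UF) by `rfl`. [this file, g47] -/
def moatIn (S K : Set E3) (r₀ ℓ : ℝ) : Set E3 := {p | p ∈ S ∧ (∃ y ∈ K, dist p y < ℓ) ∧ ∀ y ∈ K, r₀ < dist p y}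

/-- membership in the moat with inner radius `r₀`. [this file, g47] -/
theorem mem_moatIn {S K : Set E3} {r₀ ℓ : ℝ} {p : E3} : p ∈ moatIn S K r₀ ℓ ↔ p ∈ S ∧ (∃ y ∈ K, dist p y < ℓ) ∧ ∀ y ∈ K, r₀ < dist p y := Iff.rfl

/-- DICTIONARY with part UF: at inner radius `8` the moat is g46's. [this file, g47] -/
theorem moatIn_eight (S K : Set E3) (ℓ : ℝ) : moatIn S K 8 ℓ = moat S K ℓ := rfl

/-- the moat grows with the outer radius. [this file, g47] -/
theorem moatIn_mono (S K : Set E3) (r₀ : ℝ) {ℓ ℓ' : ℝ} (h : ℓ ≤ ℓ') : moatIn S K r₀ ℓ ⊆ moatIn S K r₀ ℓ' :=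
  fun _ hp => ⟨hp.1, hp.2.1.imp fun _ ⟨hy, hyl⟩ => ⟨hy, hyl.trans_le h⟩, hp.2.2⟩

/-- the moat shrinks with the inner radius. [this file, g47] -/
theorem moatIn_anti (S K : Set E3) (ℓ : ℝ) {r₀ r₀' : ℝ} (h : r₀ ≤ r₀') : moatIn S K r₀' ℓ ⊆ moatIn S K r₀ ℓ :=
  fun _ hp => ⟨hp.1, hp.2.1, fun y hy => h.trans_lt (hp.2.2 y hy)⟩

/-- ★ **`IsUnderEnvelope ϑe ωe p S H K y`** — the star of `y` lies UNDER THE ELASTIC ENVELOPE of the container `K`: for SOME core `k ∈ K` (equivalently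
the nearest) it is `(ϑe(8/d)^p, ωe(8/d)^p)`-coherent to `H` (part UD), `d = dist y k`; misfit AND tilt are enveloped. [this file, g47] -/
def IsUnderEnvelope (ϑe ωe : ℝ) (p : ℕ) (S H K : Set E3) (y : E3) : Prop :=
  ∃ k ∈ K, IsCoherentStar (envelope ϑe p (dist y k)) (envelope ωe p (dist y k)) S H y

/-- ★ **`IsDressed ϑe ωe p r₀ ℓ M S H x`** — the site `x` is DRESSED: some finite container `K ⊆ S`, `x ∈ K`, `#K ≤ M`, has its whole moat `moatIn S K r₀ ℓ`
under the `(ϑe, ωe, p)`-envelope of `K`; sandwiched between g46's enclosures (tight flat level / loose level, `r₀ = 8`), equal to enclosure at `p = 0`,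
`r₀ = 8`.  Intrinsic given `H`, registration-free.  Its negation — BARE — is the generic class ((F0g) «DressScan»). [this file, g47] -/
def IsDressed (ϑe ωe : ℝ) (p : ℕ) (r₀ ℓ : ℝ) (M : ℕ) (S H : Set E3) (x : E3) : Prop :=
  ∃ K : Set E3, K ⊆ S ∧ K.Finite ∧ x ∈ K ∧ K.ncard ≤ M ∧ ∀ y ∈ moatIn S K r₀ ℓ, IsUnderEnvelope ϑe ωe p S H K y

/-- a flat-coherent moat star below the far end of the envelope is under the envelope (of the core it is within `ℓ` of). [this file, g47] -/
theorem isUnderEnvelope_of_isCoherentStar {ϑc ωc ϑe ωe r₀ ℓ : ℝ} {p : ℕ} (he : 0 ≤ ϑe) (hw : 0 ≤ ωe) (hr : 0 ≤ r₀) (hϑ : ϑc ≤ envelope ϑe p ℓ)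
    (hω : ωc ≤ envelope ωe p ℓ) {S H K : Set E3} {y : E3} (hy : y ∈ moatIn S K r₀ ℓ) (hc : IsCoherentStar ϑc ωc S H y) :
    IsUnderEnvelope ϑe ωe p S H K y := by
  obtain ⟨_, ⟨k, hk, hkl⟩, hfar⟩ := mem_moatIn.1 hy
  have hd : 0 < dist y k := hr.trans_lt (hfar k hk)
  exact ⟨k, hk, hc.mono (hϑ.trans (envelope_outer_le he hd hkl.le p)) (hω.trans (envelope_outer_le hw hd hkl.le p))⟩

/-- a star under the envelope on a moat of inner radius `≥ 8` is flat-coherent at the loose level. [this file, g47] -/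
theorem isCoherentStar_of_isUnderEnvelope {ϑe ωe r₀ ℓ : ℝ} {p : ℕ} (he : 0 ≤ ϑe) (hw : 0 ≤ ωe) (h8 : 8 ≤ r₀) {S H K : Set E3} {y : E3}
    (hy : y ∈ moatIn S K r₀ ℓ) (hu : IsUnderEnvelope ϑe ωe p S H K y) : IsCoherentStar ϑe ωe S H y := by
  obtain ⟨k, hk, hc⟩ := hu
  have hd : 8 ≤ dist y k := h8.trans ((mem_moatIn.1 hy).2.2 k hk).le
  exact hc.mono (envelope_le_amp he hd p) (envelope_le_amp hw hd p)

/-- ★ SANDWICH, lower half (PROVED): enclosed at a TIGHT flat level (below the envelope's far end) ⇒ dressed, every `r₀ ≥ 8`. [this file, g47] -/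
theorem isDressed_of_isEnclosed {ϑc ωc ϑe ωe r₀ ℓ : ℝ} {p : ℕ} {M : ℕ} (he : 0 ≤ ϑe) (hw : 0 ≤ ωe) (h8 : 8 ≤ r₀) (hϑ : ϑc ≤ envelope ϑe p ℓ)
    (hω : ωc ≤ envelope ωe p ℓ) {S H : Set E3} {x : E3} (h : IsEnclosed ϑc ωc ℓ M S H x) : IsDressed ϑe ωe p r₀ ℓ M S H x := by
  obtain ⟨K, hKS, hKf, hxK, hKM, hc⟩ := h
  exact ⟨K, hKS, hKf, hxK, hKM, fun y hy =>
    isUnderEnvelope_of_isCoherentStar he hw (by linarith) hϑ hω hy (hc y (moatIn_anti S K ℓ h8 hy))⟩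

/-- ★ SANDWICH, upper half (PROVED): dressed with inner radius `8` ⇒ enclosed at the LOOSE flat level `(ϑe, ωe)`. [this file, g47] -/
theorem isEnclosed_of_isDressed {ϑe ωe ℓ : ℝ} {p : ℕ} {M : ℕ} (he : 0 ≤ ϑe) (hw : 0 ≤ ωe) {S H : Set E3} {x : E3}
    (h : IsDressed ϑe ωe p 8 ℓ M S H x) : IsEnclosed ϑe ωe ℓ M S H x := by
  obtain ⟨K, hKS, hKf, hxK, hKM, hu⟩ := h
  exact ⟨K, hKS, hKf, hxK, hKM, fun y hy => isCoherentStar_of_isUnderEnvelope he hw le_rfl hy (hu y hy)⟩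

/-- ★ DICTIONARY with part UF (PROVED): at exponent `0` and inner radius `8`, dressed = enclosed — g46's cut is a special case. [this file, g47] -/
theorem isDressed_zero_iff (ϑe ωe ℓ : ℝ) (M : ℕ) (S H : Set E3) (x : E3) : IsDressed ϑe ωe 0 8 ℓ M S H x ↔ IsEnclosed ϑe ωe ℓ M S H x := by
  refine exists_congr fun K => and_congr_right fun _ => and_congr_right fun _ => and_congr_right fun _ => and_congr_right fun _ => ?_
  refine forall₂_congr fun y hy => ⟨fun ⟨_, _, hc⟩ => by simpa only [envelope_exp_zero] using hc, fun hc => ?_⟩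
  obtain ⟨_, ⟨k, hk, _⟩, _⟩ := mem_moatIn.1 hy
  exact ⟨k, hk, by simpa only [envelope_exp_zero] using hc⟩

/-- dressing is monotone in the amplitudes, the inner radius and the container size, antitone in the exponent and the outer radius. [this file, g47] -/
theorem IsDressed.mono {ϑe ϑe' ωe ωe' r₀ r₀' ℓ ℓ' : ℝ} {p p' : ℕ} {M M' : ℕ} (he : 0 ≤ ϑe) (hw : 0 ≤ ωe) (h8 : 8 ≤ r₀) (hϑ : ϑe ≤ ϑe')
    (hω : ωe ≤ ωe') (hp : p' ≤ p) (hr : r₀ ≤ r₀') (hℓ : ℓ' ≤ ℓ) (hM : M ≤ M') {S H : Set E3} {x : E3} (h : IsDressed ϑe ωe p r₀ ℓ M S H x) :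
    IsDressed ϑe' ωe' p' r₀' ℓ' M' S H x := by
  obtain ⟨K, hKS, hKf, hxK, hKM, hu⟩ := h
  refine ⟨K, hKS, hKf, hxK, hKM.trans hM, fun y hy => ?_⟩
  obtain ⟨k, hk, hc⟩ := hu y (moatIn_anti S K ℓ hr (moatIn_mono S K r₀' hℓ hy))
  have hd : 8 ≤ dist y k := (h8.trans hr).trans ((mem_moatIn.1 hy).2.2 k hk).le
  exact ⟨k, hk, hc.mono ((envelope_anti_exp he hd hp).trans (envelope_mono_amp hϑ dist_nonneg p'))
    ((envelope_anti_exp hw hd hp).trans (envelope_mono_amp hω dist_nonneg p'))⟩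

/-- ★ ONE-CONTAINER CERTIFICATE (PROVED): a site whose ring `r₀ < d < ℓ` of stars lies under the envelope measured from itself is dressed (`K = {x}`)
— how the isolated hot core with an elastic halo lands on the special side. [this file, g47] -/
theorem isDressed_singleton {ϑe ωe r₀ ℓ : ℝ} {p : ℕ} {M : ℕ} (hM : 1 ≤ M) {S H : Set E3} {x : E3} (hx : x ∈ S)
    (h : ∀ y ∈ S, r₀ < dist y x → dist y x < ℓ → IsCoherentStar (envelope ϑe p (dist y x)) (envelope ωe p (dist y x)) S H y) :
    IsDressed ϑe ωe p r₀ ℓ M S H x := by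
  refine ⟨{x}, singleton_subset_iff.2 hx, finite_singleton x, mem_singleton x, by rw [ncard_singleton]; exact hM, fun y hy => ⟨x, rfl, ?_⟩⟩
  obtain ⟨hyS, ⟨k, hk, hkl⟩, hfar⟩ := mem_moatIn.1 hy
  rw [mem_singleton_iff.1 hk] at hkl
  exact h y hyS (hfar x rfl) hkl

/-- DEGENERATE END `M = 0`: no site is dressed. [this file, g47] -/
theorem not_isDressed_zero {ϑe ωe r₀ ℓ : ℝ} {p : ℕ} {S H : Set E3} {x : E3} : ¬ IsDressed ϑe ωe p r₀ ℓ 0 S H x := by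
  rintro ⟨K, _, hKf, hxK, hK0, _⟩; have h := (Set.ncard_pos hKf).2 ⟨x, hxK⟩; omega

/-- DEGENERATE END `ℓ ≤ r₀`: every site is dressed by `{x}` (empty moat) once `M ≥ 1`. [this file, g47] -/
theorem isDressed_of_le {ϑe ωe r₀ ℓ : ℝ} {p : ℕ} {M : ℕ} (hℓ : ℓ ≤ r₀) (hM : 1 ≤ M) {S H : Set E3} {x : E3} (hx : x ∈ S) :
    IsDressed ϑe ωe p r₀ ℓ M S H x :=
  isDressed_singleton hM hx fun _ _ hr hl => absurd hl (not_lt.2 (hℓ.trans hr.le))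

/-- ★ THE CHAIN STEP (PROVED): if `x` is bare, EVERY admissible container `K ∋ x` has a moat star ABOVE THE ENVELOPE OF EVERY CORE — warmer than any
elastic halo of `K` allows there: a further SOURCE; iterating from `K₀ = {x}`, a bare hot star heads a `16`-linked chain of `≥ M` sources. [this file, g47] -/
theorem exists_superEnvelope_of_not_isDressed {ϑe ωe r₀ ℓ : ℝ} {p : ℕ} {M : ℕ} {S H : Set E3} {x : E3} (h : ¬ IsDressed ϑe ωe p r₀ ℓ M S H x)
    {K : Set E3} (hKS : K ⊆ S) (hKf : K.Finite) (hxK : x ∈ K) (hKM : K.ncard ≤ M) :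
    ∃ y ∈ moatIn S K r₀ ℓ, ∀ k ∈ K, ¬ IsCoherentStar (envelope ϑe p (dist y k)) (envelope ωe p (dist y k)) S H y :=
  Classical.byContradiction fun hne => h ⟨K, hKS, hKf, hxK, hKM, fun y hy => Classical.byContradiction fun hu =>
    hne ⟨y, hy, fun k hk hc => hu ⟨k, hk, hc⟩⟩⟩

/-! ### YG.2  The cut: [I_D] (local: dressed cluster ⇒ tame), the window form [D_w], and the bare residual [T_b] -/

/-- ★★ **[I_D] «DressedCorePG ϑ ϑe ωe p r₀ ℓ M aHi Λ θ s» — A MOAT UNDER THE ELASTIC ENVELOPE FORCES A TAME CLUSTER** (the SPECIAL side, LOCAL form).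
For every θ-good `aHi`-GSC door set `S` (`IsDoorSetPG`), every equilibrium `s`-chart `(L, w)` at scale `a` (`IsEquilChart`) and every FINITE cluster
`K ⊆ S` of `≤ M` sites: if every star of `moatIn S K r₀ ℓ` lies under the `(ϑe, ωe, p)`-envelope of `K` relative to the chart lattice `LayeredHom L w` —
warm up to `ϑe(8/r₀)^p` next to the cores, cooling at least like `d^{-p}` — then every site of `K` is `ϑ`-TAME.  NO window, NO registration, NO flat
level.  `[I_K](ϑe) ⇒ [I_D](8) ⇒ [I_K](ϑc)` for `ϑc ≤ envelope ϑe p ℓ` (PROVED): at the record literals [I_D] OWNS the named scenario of [T] (isolated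
hot core + `r⁻³` halo, dressed by `K = {x}`) which g46's [I_K] at `calmLevel` does not.  Dials `DressedCorePG.mono`; trivial at `M = 0`.
MECHANISM-NAMED (HALO SLAVING: the basin part of a GSC state is discrete-harmonic up to `O(ϑe²)` — the GSC inequality against re-fitted chart patches,
[CC°_W]/[KS] localised — so feathering it to the chart filling between `r` and `2r` costs elastic flux `∝ ϑe² r^{3−2p}`, DECREASING for `p = 2` where a
flat level costs `∝ ϑc² r³`; CORE GAP: the finite certified inequality of part UF with basin boundary data) · LOCAL · FINITE · UNDECIDED(stated tests:
(F0g) «DressScan» — on the (F0b) configurations and the 54 windows of TAG 174 (a⁗), per hot site `x`: grow `K` from `{x}` by the greedy radius-`r₀`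
shadow cover of the super-envelope moat stars (`#K` in the DOMINATION reading, critic row 780 (2); closure under moat extension), `M_dr(x) := #K`,
swept over `r₀ ∈ {8, 12, 16}`, `ℓ ∈ {16, 32}`; prediction `{hot, M_dr(x) ≤ 12}` EMPTY among proxy-passing states; (F0d″) «DressGap» — (F0d′) under the envelope,
first at `M = 1`) · ATTACKABLE·L once (F0d″) reports (computer-assisted: Newton–Kantorovich around the chart filling on the halo + certified core enumeration).
Why it might fail: (a) a second clean single-site-Nash solution of the dressed-cluster boundary-value problem with a hot core and energy within the
envelope's feathering flux of the chart filling (a near-degenerate localized nonlinear mode) — none known for Lennard-Jones close packings, none seen in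
the census, no theorem excludes it; (b) `ϑe = 1/100` must lie in the basin of uniform stability (`UniformTameStability` is stated at `tameRadius = 1/20`);
(c) `r⁻⁶` interaction tails across the moat.
Sources: Braun–Hudson–Ortner, arXiv 2108.04765 (far-field expansion of lattice defect equilibria: the dipole/multipole halo); Ehrlacher–Ortner–Shapeev,
Arch. Ration. Mech. Anal. 222 (2016) 1217 (`|Du| ≲ r⁻³` for point defects); E–Ming, Arch. Ration. Mech. Anal. 183 (2007) 241 and Ortner–Theil, Arch.
Ration. Mech. Anal. 207 (2013) 1025 (stability of the Cauchy–Born filling); Braun–Schmidt, arXiv 1604.00197, pp. 2–3 (atomistic boundary-value problem);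
Knops–Payne, Uniqueness Theorems in Linear Elasticity (1971) p. 5; this tree: `CalmMoatPG`, `IsEnclosed` (part UF), `IsCoherentStar` (part UD),
`UniformTameStability` (part TP); census TAG 174 (a⁗), (F0b). [this file, g47] -/
def DressedCorePG (ϑ ϑe ωe : ℝ) (p : ℕ) (r₀ ℓ : ℝ) (M : ℕ) (aHi Λ θ s : ℝ) : Prop :=
  ∀ δ : ℝ, 0 < δ → ∀ a : ℝ, 0 < a →
    ∀ S : Set E3, IsDoorSetPG aHi δ S → (∀ q ∈ S, IsTwoShellAffineGood θ S q) →
      ∀ (L : E3 ≃L[ℝ] E3) (w : ℤ → E3), IsEquilChart a s Λ L w →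
        ∀ K : Set E3, K ⊆ S → K.Finite → K.ncard ≤ M → (∀ y ∈ moatIn S K r₀ ℓ, IsUnderEnvelope ϑe ωe p S (LayeredHom (L : E3 →L[ℝ] E3) w) K y) →
          IsTameOn ϑ S (LayeredHom (L : E3 →L[ℝ] E3) w) K

/-- ★ **[D_w] «DressedTameWindowPG ϑ ϑe ωe p r₀ ℓ M aHi Λ θ s» — [T] AT THE DRESSED SITES** (the SPECIAL side, window form): verbatim [T] `TameWindowPG ϑ`
(part UC) with the conclusion restricted to the dressed sites of `win 9R`.  WEAKER than [T] (PROVED); implied by [I_D] (PROVED, window data unused);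
with [T_b] it gives [T] back EXACTLY.  Bookkeeping form; status and tests as [I_D].  Why it might fail: only if [I_D] fails AND the window budget does
not rescue it.  Sources: as [I_D]; part UC ([T]). [this file, g47] -/
def DressedTameWindowPG (ϑ ϑe ωe : ℝ) (p : ℕ) (r₀ ℓ : ℝ) (M : ℕ) (aHi Λ θ s : ℝ) : Prop :=
  ∀ δ : ℝ, 0 < δ → ∀ a : ℝ, 0 < a → ∀ Cg : ℝ, 1 ≤ Cg → ∀ K₀ : ℝ, 0 < K₀ → ∃ η₁ : ℝ, 0 < η₁ ∧ ∃ R₁ : ℝ, 0 < R₁ ∧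
    ∀ S : Set E3, IsDoorSetPG aHi δ S → (∀ q ∈ S, IsTwoShellAffineGood θ S q) →
      ∀ η : ℝ, 0 < η → η ≤ η₁ → ∀ R : ℝ, R₁ ≤ R →
        ∀ (L : E3 ≃L[ℝ] E3) (w : ℤ → E3), IsEquilChart a s Λ L w →
          ∀ Ψ : E3 → E3, IsGlobalReg Cg η R S (LayeredHom (L : E3 →L[ℝ] E3) w) Ψ →
            K₀ ≤ η * nK (atomsIn (μS S) 0 R) →
              ∀ x ∈ atomsIn (μS S) 0 (9 * R), IsDressed ϑe ωe p r₀ ℓ M S (LayeredHom (L : E3 →L[ℝ] E3) w) x →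
                IsTameStar ϑ S (LayeredHom (L : E3 →L[ℝ] E3) w) x

/-- ★★ **[T_b] «BareTameWindowPG ϑ ϑe ωe p r₀ ℓ M aHi Λ θ s» — NEAR-FLAT FAT GSC DOOR WINDOWS HAVE NO BARE `ϑ`-HOT STAR** (the GENERIC side = the
residual): verbatim [T] with the conclusion restricted to the BARE sites of `win 9R` (`¬ IsDressed`: no container of `≤ M` sites around `x` has its
moat under the elastic envelope — by `exists_superEnvelope_of_not_isDressed` every container meets a super-elastic companion, a further source).
`[T_esc](ϑc) ⇒ [T_b](r₀)` (`8 ≤ r₀`, `ϑc ≤ envelope ϑe p ℓ`) and `[T_b](8) ⇒ [T_esc](ϑe)` (PROVED): WEAKER than g46's residual of record, STRICTLY at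
currency level (the isolated hot core with its `r⁻³` halo: escaping at `calmLevel` for small containers, but dressed).  NEW · GSC-priced ·
UNDECIDED(stated test (F0g) «DressScan»: quadrant `{hot, M_dr(x) > 12}`; kill sign: a proxy-passing near-flat window with a bare
hot star) · INSTRUMENTABLE · IDEA-NEEDED (SOURCE CHAINS: super-elastic sources of `r₀`-domination number `> M`, `ℓ`-linked through `x`; the fat sub-class is the volume-vs-
surface piece over `UniformTameStability`, thin chains the open middle; dials `M ↑`, `r₀ ↑`, `ϑe ↑`, `p ↓` shift chains to the special side).
Why it might fail: as [T] — a coherent, defect-free, self-equilibrated CHAIN of anomaly sources (single-site Nash, two-shell clean, charted) that no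
finite grand-canonical replacement at `μ = e⋆` improves; none known, none seen in the census, no theorem excludes it.
Sources: as [T] (part UC) and [T_esc] (part UF); Braun–Hudson–Ortner, arXiv 2108.04765 (what one source's halo can do); census TAG 174 (a⁗), (F0b).
[this file, g47] -/
def BareTameWindowPG (ϑ ϑe ωe : ℝ) (p : ℕ) (r₀ ℓ : ℝ) (M : ℕ) (aHi Λ θ s : ℝ) : Prop :=
  ∀ δ : ℝ, 0 < δ → ∀ a : ℝ, 0 < a → ∀ Cg : ℝ, 1 ≤ Cg → ∀ K₀ : ℝ, 0 < K₀ → ∃ η₁ : ℝ, 0 < η₁ ∧ ∃ R₁ : ℝ, 0 < R₁ ∧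
    ∀ S : Set E3, IsDoorSetPG aHi δ S → (∀ q ∈ S, IsTwoShellAffineGood θ S q) →
      ∀ η : ℝ, 0 < η → η ≤ η₁ → ∀ R : ℝ, R₁ ≤ R →
        ∀ (L : E3 ≃L[ℝ] E3) (w : ℤ → E3), IsEquilChart a s Λ L w →
          ∀ Ψ : E3 → E3, IsGlobalReg Cg η R S (LayeredHom (L : E3 →L[ℝ] E3) w) Ψ →
            K₀ ≤ η * nK (atomsIn (μS S) 0 R) →
              ∀ x ∈ atomsIn (μS S) 0 (9 * R), ¬ IsDressed ϑe ωe p r₀ ℓ M S (LayeredHom (L : E3 →L[ℝ] E3) w) x →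
                IsTameStar ϑ S (LayeredHom (L : E3 →L[ℝ] E3) w) x

/-- **[I_D] ⇒ [D_w] (PROVED)** — the local statement gives the window form (the window data are not used). [this file, g47] -/
theorem dressedTameWindowPG_of_dressedCorePG {ϑ ϑe ωe : ℝ} {p : ℕ} {r₀ ℓ : ℝ} {M : ℕ} {aHi Λ θ s : ℝ}
    (h : DressedCorePG ϑ ϑe ωe p r₀ ℓ M aHi Λ θ s) : DressedTameWindowPG ϑ ϑe ωe p r₀ ℓ M aHi Λ θ s := by
  intro δ hδ a ha Cg _ K₀ _
  refine ⟨1, one_pos, 1, one_pos, fun S hS hgood η _ _ R _ L w hLw Ψ _ _ x _ hx => ?_⟩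
  obtain ⟨K, hKS, hKf, hxK, hKM, hu⟩ := hx
  exact h δ hδ a ha S hS hgood L w hLw K hKS hKf hKM hu x hxK

/-- **[T] ⇒ [D_w] (PROVED)** — the special side is WEAKER than [T]. [this file, g47] -/
theorem dressedTameWindowPG_of_tameWindowPG {ϑ ϑe ωe : ℝ} {p : ℕ} {r₀ ℓ : ℝ} {M : ℕ} {aHi Λ θ s : ℝ} (h : TameWindowPG ϑ aHi Λ θ s) :
    DressedTameWindowPG ϑ ϑe ωe p r₀ ℓ M aHi Λ θ s := by
  intro δ hδ a ha Cg hCg K₀ hK₀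
  obtain ⟨η₁, hη₁, R₁, hR₁, h1⟩ := h δ hδ a ha Cg hCg K₀ hK₀
  exact ⟨η₁, hη₁, R₁, hR₁, fun S hS hgood η hη hηle R hR L w hLw Ψ hΨ hfat x hx _ => h1 S hS hgood η hη hηle R hR L w hLw Ψ hΨ hfat x hx⟩

/-- **[T] ⇒ [T_b] (PROVED)** — the residual is WEAKER than [T]. [this file, g47] -/
theorem bareTameWindowPG_of_tameWindowPG {ϑ ϑe ωe : ℝ} {p : ℕ} {r₀ ℓ : ℝ} {M : ℕ} {aHi Λ θ s : ℝ} (h : TameWindowPG ϑ aHi Λ θ s) :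
    BareTameWindowPG ϑ ϑe ωe p r₀ ℓ M aHi Λ θ s := by
  intro δ hδ a ha Cg hCg K₀ hK₀
  obtain ⟨η₁, hη₁, R₁, hR₁, h1⟩ := h δ hδ a ha Cg hCg K₀ hK₀
  exact ⟨η₁, hη₁, R₁, hR₁, fun S hS hgood η hη hηle R hR L w hLw Ψ hΨ hfat x hx _ => h1 S hS hgood η hη hηle R hR L w hLw Ψ hΨ hfat x hx⟩

/-- ★★★ **SEAM (PROVED): `[D_w] ∧ [T_b] ⇒ [T]`** — exhaustive dichotomy (`em` on `IsDressed`); `η₁ := min`, `R₁ := max`; literals SHARED. [this file, g47] -/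
theorem tameWindowPG_of_dressedTameWindow_of_bare {ϑ ϑe ωe : ℝ} {p : ℕ} {r₀ ℓ : ℝ} {M : ℕ} {aHi Λ θ s : ℝ}
    (hD : DressedTameWindowPG ϑ ϑe ωe p r₀ ℓ M aHi Λ θ s) (hB : BareTameWindowPG ϑ ϑe ωe p r₀ ℓ M aHi Λ θ s) : TameWindowPG ϑ aHi Λ θ s := by
  intro δ hδ a ha Cg hCg K₀ hK₀
  obtain ⟨η₁, hη₁, R₁, hR₁, h1⟩ := hD δ hδ a ha Cg hCg K₀ hK₀
  obtain ⟨η₁', hη₁', R₁', hR₁', h2⟩ := hB δ hδ a ha Cg hCg K₀ hK₀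
  refine ⟨min η₁ η₁', lt_min hη₁ hη₁', max R₁ R₁', lt_max_of_lt_left hR₁, ?_⟩
  intro S hS hgood η hη hηle R hR L w hLw Ψ hΨ hfat x hx
  by_cases hd : IsDressed ϑe ωe p r₀ ℓ M S (LayeredHom (L : E3 →L[ℝ] E3) w) x
  · exact h1 S hS hgood η hη (hηle.trans (min_le_left _ _)) R ((le_max_left _ _).trans hR) L w hLw Ψ hΨ hfat x hx hd
  · exact h2 S hS hgood η hη (hηle.trans (min_le_right _ _)) R ((le_max_right _ _).trans hR) L w hLw Ψ hΨ hfat x hx hd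

/-- ★★★ **THE PARTITION (PROVED): `[T] ⟺ [D_w] ∧ [T_b]`** at every value of the literals — the one `iff` between Props of this file. [this file, g47] -/
theorem tameWindowPG_iff_dressedTameWindow_and_bare (ϑ ϑe ωe : ℝ) (p : ℕ) (r₀ ℓ : ℝ) (M : ℕ) (aHi Λ θ s : ℝ) :
    TameWindowPG ϑ aHi Λ θ s ↔ DressedTameWindowPG ϑ ϑe ωe p r₀ ℓ M aHi Λ θ s ∧ BareTameWindowPG ϑ ϑe ωe p r₀ ℓ M aHi Λ θ s :=
  ⟨fun h => ⟨dressedTameWindowPG_of_tameWindowPG h, bareTameWindowPG_of_tameWindowPG h⟩, fun h => tameWindowPG_of_dressedTameWindow_of_bare h.1 h.2⟩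

/-- ★★★ **SEAM (PROVED): `[I_D] ∧ [T_b] ⇒ [T]`** — the local statement and the bare residual give the hot-star exclusion. [this file, g47] -/
theorem tameWindowPG_of_dressedCore_of_bare {ϑ ϑe ωe : ℝ} {p : ℕ} {r₀ ℓ : ℝ} {M : ℕ} {aHi Λ θ s : ℝ} (hI : DressedCorePG ϑ ϑe ωe p r₀ ℓ M aHi Λ θ s)
    (hB : BareTameWindowPG ϑ ϑe ωe p r₀ ℓ M aHi Λ θ s) : TameWindowPG ϑ aHi Λ θ s :=
  tameWindowPG_of_dressedTameWindow_of_bare (dressedTameWindowPG_of_dressedCorePG hI) hB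

/-! ### YG.3  The sandwich with part UF (the special side grows past [I_K], the residual shrinks inside [T_esc]); the dials; the degenerate ends -/

/-- ★★ **`[I_D](8) ⇒ [I_K](ϑc)` at every TIGHT level (PROVED)** — the g47 local statement at inner radius `8` CONTAINS g46's (and g45's [I]). [this file, g47] -/
theorem calmMoatPG_of_dressedCorePG {ϑ ϑc ωc ϑe ωe : ℝ} {p : ℕ} {ℓ : ℝ} {M : ℕ} {aHi Λ θ s : ℝ} (he : 0 ≤ ϑe) (hw : 0 ≤ ωe)
    (hϑ : ϑc ≤ envelope ϑe p ℓ) (hω : ωc ≤ envelope ωe p ℓ) (h : DressedCorePG ϑ ϑe ωe p 8 ℓ M aHi Λ θ s) : CalmMoatPG ϑ ϑc ωc ℓ M aHi Λ θ s :=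
  fun δ hδ a ha S hS hgood L w hLw K hKS hKf hKM hc =>
    h δ hδ a ha S hS hgood L w hLw K hKS hKf hKM fun y hy => isUnderEnvelope_of_isCoherentStar he hw (by norm_num) hϑ hω hy (hc y hy)

/-- **`[I_K](ϑe) ⇒ [I_D](8)` (PROVED)** — g46's local statement AT THE LOOSE LEVEL contains the g47 one at inner radius `8` (informational). [this file, g47] -/
theorem dressedCorePG_of_calmMoatPG {ϑ ϑe ωe : ℝ} {p : ℕ} {ℓ : ℝ} {M : ℕ} {aHi Λ θ s : ℝ} (he : 0 ≤ ϑe) (hw : 0 ≤ ωe)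
    (h : CalmMoatPG ϑ ϑe ωe ℓ M aHi Λ θ s) : DressedCorePG ϑ ϑe ωe p 8 ℓ M aHi Λ θ s :=
  fun δ hδ a ha S hS hgood L w hLw K hKS hKf hKM hu =>
    h δ hδ a ha S hS hgood L w hLw K hKS hKf hKM fun y hy => isCoherentStar_of_isUnderEnvelope he hw le_rfl hy (hu y hy)

/-- ★★ **THE g46 RESIDUAL IS CUT: `[T_esc](ϑc) ⇒ [T_b](r₀)` (PROVED)**, every `r₀ ≥ 8` — the g47 residual is WEAKER than g46's of record. [this file, g47] -/
theorem bareTameWindowPG_of_escapingTameWindowPG {ϑ ϑc ωc ϑe ωe : ℝ} {p : ℕ} {r₀ ℓ : ℝ} {M : ℕ} {aHi Λ θ s : ℝ} (he : 0 ≤ ϑe) (hw : 0 ≤ ωe)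
    (h8 : 8 ≤ r₀) (hϑ : ϑc ≤ envelope ϑe p ℓ) (hω : ωc ≤ envelope ωe p ℓ) (h : EscapingTameWindowPG ϑ ϑc ωc ℓ M aHi Λ θ s) :
    BareTameWindowPG ϑ ϑe ωe p r₀ ℓ M aHi Λ θ s := by
  intro δ hδ a ha Cg hCg K₀ hK₀
  obtain ⟨η₁, hη₁, R₁, hR₁, h1⟩ := h δ hδ a ha Cg hCg K₀ hK₀
  exact ⟨η₁, hη₁, R₁, hR₁, fun S hS hgood η hη hηle R hR L w hLw Ψ hΨ hfat x hx hnd =>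
    h1 S hS hgood η hη hηle R hR L w hLw Ψ hΨ hfat x hx fun henc => hnd (isDressed_of_isEnclosed he hw h8 hϑ hω henc)⟩

/-- **`[T_b](8) ⇒ [T_esc](ϑe)` (PROVED)** — the g47 residual at inner radius `8` still contains g46's AT THE LOOSE LEVEL (informational). [this file, g47] -/
theorem escapingTameWindowPG_of_bareTameWindowPG {ϑ ϑe ωe : ℝ} {p : ℕ} {ℓ : ℝ} {M : ℕ} {aHi Λ θ s : ℝ} (he : 0 ≤ ϑe) (hw : 0 ≤ ωe)
    (h : BareTameWindowPG ϑ ϑe ωe p 8 ℓ M aHi Λ θ s) : EscapingTameWindowPG ϑ ϑe ωe ℓ M aHi Λ θ s := by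
  intro δ hδ a ha Cg hCg K₀ hK₀
  obtain ⟨η₁, hη₁, R₁, hR₁, h1⟩ := h δ hδ a ha Cg hCg K₀ hK₀
  exact ⟨η₁, hη₁, R₁, hR₁, fun S hS hgood η hη hηle R hR L w hLw Ψ hΨ hfat x hx hne =>
    h1 S hS hgood η hη hηle R hR L w hLw Ψ hΨ hfat x hx fun hd => hne (isEnclosed_of_isDressed he hw hd)⟩

/-- TRADE-OFF, special side: [I_D] is monotone in `ϑ`, STRONGER with `ϑe, ωe, r₀, M`, WEAKER with the exponent `p` and the outer radius `ℓ`. [this file, g47] -/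
theorem DressedCorePG.mono {ϑ ϑ' ϑe ϑe' ωe ωe' r₀ r₀' ℓ ℓ' : ℝ} {p p' : ℕ} {M M' : ℕ} {aHi Λ θ s : ℝ} (he : 0 ≤ ϑe') (hw : 0 ≤ ωe')
    (h8 : 8 ≤ r₀') (hϑ : ϑ ≤ ϑ') (hϑe : ϑe' ≤ ϑe) (hωe : ωe' ≤ ωe) (hp : p ≤ p') (hr : r₀' ≤ r₀) (hℓ : ℓ ≤ ℓ') (hM : M' ≤ M)
    (h : DressedCorePG ϑ ϑe ωe p r₀ ℓ M aHi Λ θ s) : DressedCorePG ϑ' ϑe' ωe' p' r₀' ℓ' M' aHi Λ θ s := by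
  intro δ hδ a ha S hS hgood L w hLw K hKS hKf hKM hu
  refine (h δ hδ a ha S hS hgood L w hLw K hKS hKf (hKM.trans hM) fun y hy => ?_).mono hϑ subset_rfl
  obtain ⟨k, hk, hc⟩ := hu y (moatIn_anti S K ℓ' hr (moatIn_mono S K r₀ hℓ hy))
  have hd : 8 ≤ dist y k := (h8.trans hr).trans ((mem_moatIn.1 hy).2.2 k hk).le
  exact ⟨k, hk, hc.mono ((envelope_anti_exp he hd hp).trans (envelope_mono_amp hϑe dist_nonneg p))
    ((envelope_anti_exp hw hd hp).trans (envelope_mono_amp hωe dist_nonneg p))⟩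

/-- TRADE-OFF, generic side: [T_b] is monotone in `ϑ`, WEAKER with `ϑe, ωe, r₀, M`, with `p` decreasing, `ℓ` shrinking — opposite to [I_D]: a dial
shifts content between the two sides, never out of the pair (`tameWindowPG_iff_dressedTameWindow_and_bare`). [this file, g47] -/
theorem BareTameWindowPG.anti {ϑ ϑ' ϑe ϑe' ωe ωe' r₀ r₀' ℓ ℓ' : ℝ} {p p' : ℕ} {M M' : ℕ} {aHi Λ θ s : ℝ} (he : 0 ≤ ϑe) (hw : 0 ≤ ωe) (h8 : 8 ≤ r₀)
    (hϑ : ϑ ≤ ϑ') (hϑe : ϑe ≤ ϑe') (hωe : ωe ≤ ωe') (hp : p' ≤ p) (hr : r₀ ≤ r₀') (hℓ : ℓ' ≤ ℓ) (hM : M ≤ M')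
    (h : BareTameWindowPG ϑ ϑe ωe p r₀ ℓ M aHi Λ θ s) : BareTameWindowPG ϑ' ϑe' ωe' p' r₀' ℓ' M' aHi Λ θ s := by
  intro δ hδ a ha Cg hCg K₀ hK₀
  obtain ⟨η₁, hη₁, R₁, hR₁, h1⟩ := h δ hδ a ha Cg hCg K₀ hK₀
  exact ⟨η₁, hη₁, R₁, hR₁, fun S hS hgood η hη hηle R hR L w hLw Ψ hΨ hfat x hx hnd =>
    (h1 S hS hgood η hη hηle R hR L w hLw Ψ hΨ hfat x hx fun hd => hnd (hd.mono he hw h8 hϑe hωe hp hr hℓ hM)).mono hϑ⟩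

/-- DEGENERATE END `M = 0` (vacuity guard): [I_D] holds trivially. [this file, g47] -/
theorem dressedCorePG_zero (ϑ ϑe ωe : ℝ) (p : ℕ) (r₀ ℓ aHi Λ θ s : ℝ) : DressedCorePG ϑ ϑe ωe p r₀ ℓ 0 aHi Λ θ s := by
  intro δ _ a _ S _ _ L w _ K _ hKf hK0 _ x hx; have h := (Set.ncard_pos hKf).2 ⟨x, hx⟩; omega

/-- DEGENERATE END `M = 0`: [T_b] at `M = 0` is [T] itself. [this file, g47] -/
theorem tameWindowPG_of_bareTameWindowPG_zero {ϑ ϑe ωe : ℝ} {p : ℕ} {r₀ ℓ aHi Λ θ s : ℝ} (h : BareTameWindowPG ϑ ϑe ωe p r₀ ℓ 0 aHi Λ θ s) :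
    TameWindowPG ϑ aHi Λ θ s := by
  intro δ hδ a ha Cg hCg K₀ hK₀
  obtain ⟨η₁, hη₁, R₁, hR₁, h1⟩ := h δ hδ a ha Cg hCg K₀ hK₀
  exact ⟨η₁, hη₁, R₁, hR₁, fun S hS hgood η hη hηle R hR L w hLw Ψ hΨ hfat x hx => h1 S hS hgood η hη hηle R hR L w hLw Ψ hΨ hfat x hx not_isDressed_zero⟩

/-- DEGENERATE END `ℓ ≤ r₀` (vacuity guard): [T_b] holds vacuously once `M ≥ 1`; the record `r₀ = 8 < ℓ = 16`, `M = 12` is populated. [this file, g47] -/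
theorem bareTameWindowPG_of_le {ϑ ϑe ωe : ℝ} {p : ℕ} {r₀ ℓ : ℝ} {M : ℕ} {aHi Λ θ s : ℝ} (hℓ : ℓ ≤ r₀) (hM : 1 ≤ M) :
    BareTameWindowPG ϑ ϑe ωe p r₀ ℓ M aHi Λ θ s := by
  intro δ _ a _ Cg _ K₀ _
  exact ⟨1, one_pos, 1, one_pos, fun S _ _ η _ _ R _ L w _ Ψ _ _ x hx hnd => absurd (isDressed_of_le hℓ hM (atomsIn_subset S (9 * R) hx)) hnd⟩

/-! ### YG.4  The line down to (M) and the record literals -/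

/-- the DRESS LEVEL of record (amplitude at `d = 8`, misfit and tilt): `1/100` — in the basin, above the halo `6.3·10⁻³` of a minimally hot core. [this file, g47] -/
def dressLevel : ℝ := 1 / 100

/-- the DRESS EXPONENT of record: `2` (dominates the dipole decay `3` with room; far end `(1/100)·(8/16)² = 1/400 ≥ calmLevel`). [this file, g47] -/
def dressExponent : ℕ := 2

/-- the dress level is nonnegative. [this file, g47] -/
theorem dressLevel_nonneg : 0 ≤ dressLevel := by norm_num [dressLevel]

/-- ★ THE RECORD INSTANCE OF THE SANDWICH HYPOTHESIS: `calmLevel = 1/2000 ≤ (1/100)·(8/16)^2 = 1/400`, the record envelope's far end. [this file, g47] -/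
theorem calmLevel_le_envelope_record : calmLevel ≤ envelope dressLevel dressExponent collarRadius := by
  norm_num [calmLevel, envelope, dressLevel, dressExponent, collarRadius]

/-- ★★★ **COROLLARY (PROVED): the dressed-core line down to (M)** — with the Gehring leaf (part UB): `[I_D] ∧ [T_b] ∧ [KS] ∧ [W] ∧ [CC°_W] ∧ leaf ⇒
StrainNonConcentrationPG` (`aHi ≤ 8/7`). [this file, g47] -/
theorem strainNonConcentrationPG_of_dressedCore_line {ϑ ϑe ωe : ℝ} {p : ℕ} {r₀ ℓ : ℝ} {M : ℕ} {aHi Λ θ s : ℝ} (haHi : aHi ≤ 8 / 7)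
    (hG : ZatorskaGoldstein2005_localGehringLemmaCounting) (hI : DressedCorePG ϑ ϑe ωe p r₀ ℓ M aHi Λ θ s)
    (hB : BareTameWindowPG ϑ ϑe ωe p r₀ ℓ M aHi Λ θ s) (hKS : KornSobolevPoincareP aHi θ) (hW : CoherentWindowPG ϑ aHi Λ θ s)
    (hC : CoherentGscCaccioppoliPG ϑ aHi Λ θ s) : StrainNonConcentrationPG aHi Λ θ s :=
  strainNonConcentrationPG_of_coherent_line haHi hG (tameWindowPG_of_dressedCore_of_bare hI hB) hKS hW hC

/-- ★ Record example at `(aHi; Λ, θ, s; ϑ; ϑe, ωe, p, r₀, ℓ, M) = (1; 2, 1/16, 1/50; tameRadius; dressLevel, dressLevel, dressExponent, 8, collarRadius,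
clusterSize)`, THE SANDWICH: [I_D] gives g46's [I_K] at `calmLevel`, g46's residual of record [T_esc] gives [T_b], and the pair feeds the line to [C]. -/
example (hI : DressedCorePG tameRadius dressLevel dressLevel dressExponent 8 collarRadius clusterSize 1 2 (1 / 16) (1 / 50))
    (hX : EscapingTameWindowPG tameRadius calmLevel calmLevel collarRadius clusterSize 1 2 (1 / 16) (1 / 50))
    (hKS : KornSobolevPoincareP 1 (1 / 16)) (hW : CoherentWindowPG tameRadius 1 2 (1 / 16) (1 / 50))
    (hC : CoherentGscCaccioppoliPG tameRadius 1 2 (1 / 16) (1 / 50)) :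
    CalmMoatPG tameRadius calmLevel calmLevel collarRadius clusterSize 1 2 (1 / 16) (1 / 50) ∧
      BareTameWindowPG tameRadius dressLevel dressLevel dressExponent 8 collarRadius clusterSize 1 2 (1 / 16) (1 / 50) ∧
        RigidCaccioppoliPG 1 2 (1 / 16) (1 / 50) :=
  have hB := bareTameWindowPG_of_escapingTameWindowPG dressLevel_nonneg dressLevel_nonneg le_rfl calmLevel_le_envelope_record
    calmLevel_le_envelope_record hX
  ⟨calmMoatPG_of_dressedCorePG dressLevel_nonneg dressLevel_nonneg calmLevel_le_envelope_record calmLevel_le_envelope_record hI, hB,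
    rigidCaccioppoliPG_of_coherent_line (tameWindowPG_of_dressedCore_of_bare hI hB) hKS hW hC⟩

end Summit.AtomisticToContinuum.Crystallization.Theorems.ChartedZeroExcessLayeredLatticeLiouville

end
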